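import Summits.ValiantsHypothesis.ValiantsHypothesis.Theorems.LacunarySymmetroidMatrixDescartesLagrangeMirrorDefs
import Summits.ValiantsHypothesis.ValiantsHypothesis.Theorems.LacunarySymmetroidMatrixDescartesLagrangeTowerSecular

/-!
# `MatrixDescartes` census — two-sided (mirror) Lagrange tower: partial fractions with arbitrary root vectors and orientation

HONEST FRAMING.  Object-search cell `pub-symmetroid`, crux `Theses.LacunarySymmetroid.MatrixDescartes`
(stmt-ValiantsHypothesis-18050); seat val-sym-mdr-p1 (g2).  Part of the kernel port of the cell's TWO-SIDED Lagrange tower P4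
(conjb-3 g4, ROUND4-MEMO §2) in the seat's arrowhead form (`…LagrangeMirrorDefs`): for EVERY `m ≥ 1` some real symmetric FOUR-term
lacunary `m × m` pencil has `m² + 2m` distinct positive determinant roots (`¬ PosRootLawAt m 4 ((m+1)² − 2)`).  A LOWER-bound /
construction statement in census (CONJECTURE-A) currency for the `K = 4` column; it proves nothing about the crux `MatrixDescartes`
(an upper-bound statement at fat formats), nothing about the cubic-vs-quadratic fork beyond this floor, and nothing about `VP ≠ VNP`.
No definitions in this file.

THIS FILE. `Gen.*` versions of the windows-free algebra of `…LagrangeTowerSecular`: the PARTIAL-FRACTION IDENTITY `Gen.Ppoly_eq : P = L·N + Σ_l r_l·N_l`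
for arbitrary increasing child roots `ν` (below `5`) and parent roots `z`, and the orientation-dependent signs of `P(ν_l)` (`s^{k+1}`) and `N(z_i)`
(`(−1)^k s^k`) for `s = 1` (parent below) or `s = −1` (parent above). [folklore]
-/

-- `Summit.ValiantsHypothesis.ValiantsHypothesis.…` repeats a component by the D-0017 layout
-- (single-conjunct summit), which the `dupNamespace` linter flags; the name is mandated.
set_option linter.dupNamespace false

namespace Summit.ValiantsHypothesis.ValiantsHypothesis.Theorems.LacunarySymmetroidMatrixDescartes.Census.LagrangeTower

open Matrix Polynomial Finset
open scoped BigOperators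

namespace Gen

section PartialFractions

variable {k : ℕ} (ν : Fin k → ℝ) (z : Fin (k + 1) → ℝ)

/-- `P(x) = ∏_i (x − z_i)`. -/
theorem eval_Ppoly (x : ℝ) : (Ppoly z).eval x = ∏ i : Fin (k + 1), (x - z i) := by
  simp [Ppoly, Polynomial.eval_prod]

/-- `N(x) = ∏_l (x − ν_l)`. -/
theorem eval_Npoly (x : ℝ) : (Npoly ν).eval x = ∏ l : Fin k, (x - ν l) := by
  simp [Npoly, Polynomial.eval_prod]

/-- `N_l(x) = ∏_{j ≠ l} (x − ν_j)`. -/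
theorem eval_Nlpoly (l : Fin k) (x : ℝ) : (Nlpoly ν l).eval x = ∏ j ∈ univ.erase l, (x - ν j) := by
  simp [Nlpoly, Polynomial.eval_prod]

/-- `L(x) = lconst + lslope·x`. -/
theorem eval_Lpoly (x : ℝ) : (Lpoly ν z).eval x = lconst ν z + lslope ν z * x := by
  simp [Lpoly]

/-- `N = (X − ν_l) · N_l`. -/
theorem Npoly_eq_mul (l : Fin k) : Npoly ν = (X - C (ν l)) * Nlpoly ν l := by
  unfold Npoly Nlpoly
  exact (Finset.mul_prod_erase (univ : Finset (Fin k)) (fun j => X - C (ν j)) (mem_univ l)).symm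

/-- `N(x) = (x − ν_l)·N_l(x)`. -/
theorem eval_Npoly_eq_mul (l : Fin k) (x : ℝ) :
    (Npoly ν).eval x = (x - ν l) * (Nlpoly ν l).eval x := by
  rw [Npoly_eq_mul ν l]; simp

/-- `N_j(ν_l) = 0` for `j ≠ l`. -/
theorem eval_Nlpoly_root_ne {j l : Fin k} (h : j ≠ l) : (Nlpoly ν j).eval (ν l) = 0 := by
  rw [eval_Nlpoly]
  exact Finset.prod_eq_zero (Finset.mem_erase.mpr ⟨h.symm, mem_univ _⟩) (by simp)

/-- `N_l(ν_l)` has sign `(−1)^{k−1−l}` for increasing `ν`. -/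
theorem eval_Nlpoly_root_sign (hν : StrictMono ν) (l : Fin k) :
    0 < (-1) ^ (k - 1 - (l : ℕ)) * (Nlpoly ν l).eval (ν l) := by
  rw [eval_Nlpoly]
  exact prod_erase_sub_sign _ hν l

/-- `N_l(ν_l) ≠ 0`. -/
theorem eval_Nlpoly_root_ne_zero (hν : StrictMono ν) (l : Fin k) : (Nlpoly ν l).eval (ν l) ≠ 0 := by
  intro h
  have := eval_Nlpoly_root_sign ν hν l
  rw [h, mul_zero] at this
  exact lt_irrefl _ this

/-- `N(ν_l) = 0`. -/
theorem eval_Npoly_root (l : Fin k) : (Npoly ν).eval (ν l) = 0 := by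
  rw [eval_Npoly_eq_mul ν l]; simp

/-- `N(x) ≠ 0` off the child's roots. -/
theorem eval_Npoly_ne_zero {x : ℝ} (hx : ∀ l, x ≠ ν l) : (Npoly ν).eval x ≠ 0 := by
  rw [eval_Npoly]
  exact Finset.prod_ne_zero_iff.mpr fun l _ => sub_ne_zero.mpr (hx l)

/-- `P(z_i) = 0`. -/
theorem eval_Ppoly_root (i : Fin (k + 1)) : (Ppoly z).eval (z i) = 0 := by
  rw [eval_Ppoly]
  exact Finset.prod_eq_zero (mem_univ i) (by simp)

/-- The linear part takes the designed value at the node `5`. -/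
theorem eval_Lpoly_five : (Lpoly ν z).eval 5 = lval ν z 5 := by
  rw [eval_Lpoly]; unfold lconst; ring

/-- `L(6) = lval 6`. -/
theorem eval_Lpoly_six : (Lpoly ν z).eval 6 = lval ν z 6 := by
  rw [eval_Lpoly]; unfold lconst lslope; ring

/-- `lval w · N(w) = P(w) − Σ_l r_l N_l(w)` off the roots. -/
theorem lval_mul_Npoly {w : ℝ} (hw : ∀ l, w ≠ ν l) :
    lval ν z w * (Npoly ν).eval w = (Ppoly z).eval w - ∑ l, rcoef ν z l * (Nlpoly ν l).eval w := by
  unfold lval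
  rw [div_mul_cancel₀ _ (eval_Npoly_ne_zero ν hw)]

/-- Degree bookkeeping: `deg P ≤ k+1`. -/
theorem natDegree_Ppoly_le : (Ppoly z).natDegree ≤ k + 1 := by
  unfold Ppoly
  refine (Polynomial.natDegree_prod_le _ _).trans ?_
  simp

/-- `deg N ≤ k`. -/
theorem natDegree_Npoly_le : (Npoly ν).natDegree ≤ k := by
  unfold Npoly
  refine (Polynomial.natDegree_prod_le _ _).trans ?_
  simp

/-- `deg N_l ≤ k`. -/
theorem natDegree_Nlpoly_le (l : Fin k) : (Nlpoly ν l).natDegree ≤ k := by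
  unfold Nlpoly
  refine (Polynomial.natDegree_prod_le _ _).trans ?_
  refine (Finset.sum_le_sum (fun j _ => Polynomial.natDegree_X_sub_C_le (ν j))).trans ?_
  simp only [Finset.sum_const, smul_eq_mul, mul_one]
  exact (Finset.card_erase_le).trans (by simp)

/-- `deg L ≤ 1`. -/
theorem natDegree_Lpoly_le : (Lpoly ν z).natDegree ≤ 1 := by
  unfold Lpoly
  rw [add_comm]
  exact Polynomial.natDegree_linear_le

/-- The right-hand side of the partial-fraction identity has degree `≤ k+1`. -/
theorem natDegree_rhs_le :
    (Lpoly ν z * Npoly ν + ∑ l, C (rcoef ν z l) * Nlpoly ν l).natDegree ≤ k + 1 := by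
  refine (Polynomial.natDegree_add_le _ _).trans (max_le ?_ ?_)
  · refine (Polynomial.natDegree_mul_le).trans ?_
    have := natDegree_Lpoly_le ν z; have := natDegree_Npoly_le ν; omega
  · refine (Polynomial.natDegree_sum_le_of_forall_le _ _ fun l _ => ?_)
    refine (Polynomial.natDegree_C_mul_le _ _).trans ((natDegree_Nlpoly_le ν l).trans (by omega))

/-- **Partial fractions, as a polynomial identity**: `P = L·N + Σ_l r_l·N_l` — both sides have degree `≤ k+1` and agree at the
`k+2` points `ν_0, …, ν_{k−1}, 5, 6` (the `ν_l` are assumed `< 5`). -/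
theorem Ppoly_eq (hν : StrictMono ν) (hν5 : ∀ l, ν l < 5) :
    Ppoly z = Lpoly ν z * Npoly ν + ∑ l, C (rcoef ν z l) * Nlpoly ν l := by
  classical
  have five_ne : ∀ l, (5 : ℝ) ≠ ν l := fun l => (hν5 l).ne'
  have six_ne : ∀ l, (6 : ℝ) ≠ ν l := fun l => by have := hν5 l; intro h; linarith
  let f : Fin k ⊕ Bool → ℝ := Sum.elim ν (fun b => bif b then 6 else 5)
  have hf5 : f (Sum.inr false) = 5 := rfl
  have hf6 : f (Sum.inr true) = 6 := rfl
  have hf : Function.Injective f := by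
    rintro (a | a) (b | b) h
    · exact congrArg Sum.inl (hν.injective h)
    · exfalso
      cases b
      · rw [hf5] at h; exact five_ne a h.symm
      · rw [hf6] at h; exact six_ne a h.symm
    · exfalso
      cases a
      · rw [hf5] at h; exact five_ne b h
      · rw [hf6] at h; exact six_ne b h
    · cases a <;> cases b
      · rfl
      · exfalso; rw [hf5, hf6] at h; norm_num at h
      · exfalso; rw [hf5, hf6] at h; norm_num at h
      · rfl
  apply Polynomial.eq_of_natDegree_lt_card_of_eval_eq _ _ hf
  · rintro (l | b)
    · simp only [f, Sum.elim_inl, Polynomial.eval_add, Polynomial.eval_mul, eval_Npoly_root, mul_zero,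
        zero_add, Polynomial.eval_finsetSum, Polynomial.eval_C]
      rw [Finset.sum_eq_single l]
      · unfold rcoef; rw [div_mul_cancel₀ _ (eval_Nlpoly_root_ne_zero ν hν l)]
      · intro j _ hj; rw [eval_Nlpoly_root_ne ν hj, mul_zero]
      · intro h; exact absurd (mem_univ l) h
    · cases b
      · rw [hf5, Polynomial.eval_add, Polynomial.eval_mul, eval_Lpoly_five, lval_mul_Npoly ν z five_ne]
        simp [Polynomial.eval_finsetSum]
      · rw [hf6, Polynomial.eval_add, Polynomial.eval_mul, eval_Lpoly_six, lval_mul_Npoly ν z six_ne]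
        simp [Polynomial.eval_finsetSum]
  · simp only [Fintype.card_sum, Fintype.card_fin, Fintype.card_bool]
    have h1 := natDegree_Ppoly_le z
    have h2 := natDegree_rhs_le ν z
    exact max_lt (by omega) (by omega)

/-- Evaluated partial fractions: `P(x) = L(x) N(x) + Σ_l r_l N_l(x)`. -/
theorem eval_Ppoly_eq (hν : StrictMono ν) (hν5 : ∀ l, ν l < 5) (x : ℝ) :
    (Ppoly z).eval x = (Lpoly ν z).eval x * (Npoly ν).eval x + ∑ l, rcoef ν z l * (Nlpoly ν l).eval x := by
  conv_lhs => rw [Ppoly_eq ν z hν hν5]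
  simp [Polynomial.eval_finsetSum]

/-! ### Orientation-dependent signs: `s = 1` (parent below child) or `s = −1` (parent above child) -/

/-- `P(ν_l)` has sign `s^{k+1}`. -/
theorem eval_Ppoly_child_root_sign {s : ℝ}
    (hsep : (s = 1 ∧ ∀ i l, z i < ν l) ∨ (s = -1 ∧ ∀ i l, ν l < z i)) (l : Fin k) :
    0 < s ^ (k + 1) * (Ppoly z).eval (ν l) := by
  rw [eval_Ppoly]
  rcases hsep with ⟨rfl, h⟩ | ⟨rfl, h⟩
  · rw [one_pow, one_mul]
    exact Finset.prod_pos fun i _ => sub_pos.mpr (h i l)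
  · exact prod_sub_rev_sign z (ν l) fun i => h i l

/-- `N(z_i)` has sign `(−1)^k s^k`. -/
theorem eval_Npoly_parent_root_sign {s : ℝ}
    (hsep : (s = 1 ∧ ∀ i l, z i < ν l) ∨ (s = -1 ∧ ∀ i l, ν l < z i)) (i : Fin (k + 1)) :
    0 < (-1) ^ k * s ^ k * (Npoly ν).eval (z i) := by
  rw [eval_Npoly]
  rcases hsep with ⟨rfl, h⟩ | ⟨rfl, h⟩
  · rw [one_pow, mul_one]
    exact prod_sub_rev_sign _ _ fun l => h i l
  · rw [← mul_pow, show (-1 : ℝ) * -1 = 1 by norm_num, one_pow, one_mul]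
    exact Finset.prod_pos fun l _ => sub_pos.mpr (h i l)

/-- Parent and child roots never coincide. -/
theorem z_ne_ν {s : ℝ} (hsep : (s = 1 ∧ ∀ i l, z i < ν l) ∨ (s = -1 ∧ ∀ i l, ν l < z i))
    (i : Fin (k + 1)) (l : Fin k) : z i ≠ ν l := by
  rcases hsep with ⟨_, h⟩ | ⟨_, h⟩
  · exact (h i l).ne
  · exact (h i l).ne'

/-- `N(z_i) ≠ 0` at a parent root. -/
theorem eval_Npoly_parent_root_ne_zero {s : ℝ}
    (hsep : (s = 1 ∧ ∀ i l, z i < ν l) ∨ (s = -1 ∧ ∀ i l, ν l < z i)) (i : Fin (k + 1)) :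
    (Npoly ν).eval (z i) ≠ 0 :=
  eval_Npoly_ne_zero ν fun l => z_ne_ν ν z hsep i l

end PartialFractions

end Gen

end Summit.ValiantsHypothesis.ValiantsHypothesis.Theorems.LacunarySymmetroidMatrixDescartes.Census.LagrangeTower
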